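import Mathlib
import Summits.MatrixMultiplication.Statement
import Summits.MatrixMultiplication.MatrixMultiplication.Theorems.GraphEquationsCostRank
import Summits.MatrixMultiplication.MatrixMultiplication.Theorems.GraphEquationsCoeffIdentity
import Summits.MatrixMultiplication.MatrixMultiplication.Theorems.GraphEquationsForwardADBlocks
import Summits.MatrixMultiplication.MatrixMultiplication.Theorems.GraphEquationsRowCriterion

/-!
# GraphEquations — AFFINE DEFLATION is free, and the osculating identity of a deflated test
# (M18b, decomp-mm-lens-5 g31)

(supports `MultiplicityReduction`, stmt-MatrixMultiplication-27806, hand 1 = BOP′ at `K = 2`.)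

Two unconditional facts behind JET TRUNCATION (module `GraphEquationsJetTruncation`):

* `IsNonscalarSeq.derivC_affine` — **derivation along an AFFINE coefficient field is cost-free in
  Ostrowski's model**: if `ξ_q ∈ ℂ[A,B]` are affine-linear then every nonscalar sequence `gs` extends
  to a nonscalar `gs'`, `|gs'| ≤ 3|gs|`, whose free span contains the free span of `gs` AND its image
  under `D_ξ = Σ_q ι(ξ_q) ∂/∂c_q` (Leibniz; [BurgisserClausenShokrollahi1997, §4.1 Rem. (4.3), (4.7)]).
  Contrast: as a CIRCUIT a generic affine field costs `≈ 2n⁴` gates (the g28 dead end) — the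
  nonscalar model is the right currency for deflation.
* `coeff_ab_graphRestrict` — the **unconditional osculating coefficient identity**
  `coeff_{a_ij b_j'l}(t|_W) = coeff_{a_ij b_j'l}(t) + [j = j']·coeff_{c_il}(t)` for EVERY
  `t ∈ ℂ[A,B,C]` (the tree's two-parameter probe `probe_coeff_bind₁` pushed through `graphRestrict`;
  the tree's `coeffIdentity` is the case `t|_W = 0`).
* `oscId_derivC` — for a deflated test `D_ξ t` (`(D_ξ t)|_W = Σ_q ξ_q r_q(t)`, tree
  `graphRestrict_derivC`): if the `a ⊗ b`-part of `Σ_q ξ_q r_q(t) + Σ_q coeff_{c_q}(t)·M_q` vanishes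
  (LIFT: `ξ + M` is a kernel 2-jet of the rows in the `a ⊗ b` directions), then
  `coeff_{a_ij b_j'l}(D_ξ t) = −[j=j']·coeff_{c_il}(D_ξ t) − Σ_q coeff_{c_q}(t)·coeff_{a_ij b_j'l}(M_q)` —
  the osculating identity of M18a with error columns = the OLD Jacobian columns.

No `sorry`.  Sources: [LeykinVerscheldeZhao2006, Thm. 3.1]; [BurgisserClausenShokrollahi1997,
§4.1, (14.8)]; [Strassen1973].
-/

set_option linter.dupNamespace false

noncomputable section

open scoped BigOperators

namespace Summit.MatrixMultiplication.MatrixMultiplication.Theorems.GraphEquations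

open MvPolynomial
open Literature.Computability.AlgebraicComplexity
open Literature.Computability.AlgebraicComplexity.ArithCircuit

variable {n : ℕ}

/-! ## `D_ξ` along an AFFINE field is free in Ostrowski's model -/

/-- `D_ξ` as a `ℂ`-linear map. -/
def derivCLin (ξ : Fin n × Fin n → MvPolynomial (MatMulVars n) ℂ) :
    MvPolynomial (GraphVars n) ℂ →ₗ[ℂ] MvPolynomial (GraphVars n) ℂ where
  toFun := derivC ξ
  map_add' := derivC_add ξ
  map_smul' := derivC_smul ξ

/-- `derivCLin ξ u = D_ξ u`. -/
@[simp] theorem derivCLin_apply (ξ : Fin n × Fin n → MvPolynomial (MatMulVars n) ℂ)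
    (u : MvPolynomial (GraphVars n) ℂ) : derivCLin ξ u = derivC ξ u := rfl

/-- **Nonscalar sequences are closed under derivation along an AFFINE coefficient field, at length
`× 3`.**  If `ξ_q ∈ ℂ[A,B]` are affine-linear (cost-free given nothing), then for every nonscalar
sequence `gs` there is a nonscalar sequence `gs'`, `|gs'| ≤ 3|gs|`, whose cost-free span contains the
cost-free span of `gs` and its image under `D_ξ` (Leibniz: `D(uv) = Du·v + u·Dv`, two new products per
old one; `D` of an affine combination of inputs is affine, hence free). -/
theorem IsNonscalarSeq.derivC_affine (ξ : Fin n × Fin n → MvPolynomial (MatMulVars n) ℂ)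
    (hξ : ∀ q, liftAB n (ξ q) ∈ freeSpan (∅ : Set (MvPolynomial (GraphVars n) ℂ)))
    {gs : List (MvPolynomial (GraphVars n) ℂ)} (hgs : IsNonscalarSeq gs) :
    ∃ gs' : List (MvPolynomial (GraphVars n) ℂ), IsNonscalarSeq gs' ∧ gs'.length ≤ 3 * gs.length ∧
      (∀ p ∈ freeSpan {x | x ∈ gs}, p ∈ freeSpan {x | x ∈ gs'}) ∧
      (∀ p ∈ freeSpan {x | x ∈ gs}, derivC ξ p ∈ freeSpan {x | x ∈ gs'}) := by
  induction gs with
  | nil =>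
    refine ⟨[], isNonscalarSeq_nil, by simp, fun p hp => hp, fun p hp => ?_⟩
    refine apply_mem_of_mem_freeSpan (derivCLin ξ) ?_ ?_ ?_ hp
    · simp only [derivCLin_apply, derivC_one]; exact Submodule.zero_mem _
    · intro v
      rcases v with v | q
      · simp only [derivCLin_apply, derivC_X_inl]; exact Submodule.zero_mem _
      · simp only [derivCLin_apply, derivC_X_inr]
        exact freeSpan_mono (Set.empty_subset _) (hξ q)
    · intro s hs; simp at hs
  | cons g gs ih =>
    obtain ⟨hgs0, u, hu, v, hv, rfl⟩ := hgs
    obtain ⟨gs', hns', hlen', hsub, hD⟩ := ih hgs0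
    -- the new sequence: `u·Dv :: Du·v :: u·v :: gs'`
    set gs'' : List (MvPolynomial (GraphVars n) ℂ) :=
      (u * derivC ξ v) :: (derivC ξ u * v) :: (u * v) :: gs' with hgs''
    have hmono1 : freeSpan {x | x ∈ gs'} ≤ freeSpan {x | x ∈ (u * v) :: gs'} :=
      freeSpan_mono fun x hx => by simp only [Set.mem_setOf_eq, List.mem_cons]; exact Or.inr hx
    have hmono2 : freeSpan {x | x ∈ (u * v) :: gs'} ≤
        freeSpan {x | x ∈ (derivC ξ u * v) :: (u * v) :: gs'} :=
      freeSpan_mono fun x hx => by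
        simp only [Set.mem_setOf_eq, List.mem_cons] at hx ⊢; exact Or.inr hx
    have hmono3 : freeSpan {x | x ∈ (derivC ξ u * v) :: (u * v) :: gs'} ≤
        freeSpan {x | x ∈ gs''} :=
      freeSpan_mono fun x hx => by
        simp only [hgs'', Set.mem_setOf_eq, List.mem_cons] at hx ⊢; exact Or.inr hx
    have hns'' : IsNonscalarSeq gs'' := by
      refine ⟨⟨⟨hns', u, hsub u hu, v, hsub v hv, rfl⟩, derivC ξ u, hmono1 (hD u hu), v,
        hmono1 (hsub v hv), rfl⟩, u, hmono2 (hmono1 (hsub u hu)), derivC ξ v,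
        hmono2 (hmono1 (hD v hv)), rfl⟩
    have hsub'' : ∀ p ∈ freeSpan {x | x ∈ (u * v) :: gs}, p ∈ freeSpan {x | x ∈ gs''} := by
      intro p hp
      refine apply_mem_of_mem_freeSpan LinearMap.id ?_ ?_ ?_ hp
      · exact one_mem_freeSpan _
      · intro i; exact X_mem_freeSpan _ i
      · intro s hs
        simp only [Set.mem_setOf_eq, List.mem_cons] at hs
        rcases hs with rfl | hs
        · exact mem_freeSpan_of_mem (by simp [hgs''])
        · exact hmono3 (hmono2 (hmono1 (hsub s (mem_freeSpan_of_mem hs))))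
    refine ⟨gs'', hns'', by simp [hgs'']; omega, hsub'', fun p hp => ?_⟩
    refine apply_mem_of_mem_freeSpan (derivCLin ξ) ?_ ?_ ?_ hp
    · simp only [derivCLin_apply, derivC_one]; exact Submodule.zero_mem _
    · intro w
      rcases w with w | q
      · simp only [derivCLin_apply, derivC_X_inl]; exact Submodule.zero_mem _
      · simp only [derivCLin_apply, derivC_X_inr]
        exact freeSpan_mono (Set.empty_subset _) (hξ q)
    · intro s hs
      simp only [Set.mem_setOf_eq, List.mem_cons] at hs
      rcases hs with rfl | hs
      · rw [derivCLin_apply, derivC_mul]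
        exact Submodule.add_mem _ (mem_freeSpan_of_mem (by simp [hgs'']))
          (mem_freeSpan_of_mem (by simp [hgs'']))
      · exact hmono3 (hmono2 (hmono1 (hD s (mem_freeSpan_of_mem hs))))

/-- Constant fields and fields with affine-linear entries `C κ + Σ_v λ_v X_v` are free. -/
theorem liftAB_affine_mem_freeSpan (κ : ℂ) (lam : MatMulVars n → ℂ) :
    liftAB n (C κ + ∑ v, lam v • X v) ∈ freeSpan (∅ : Set (MvPolynomial (GraphVars n) ℂ)) := by
  rw [map_add, liftAB_C, map_sum]
  refine Submodule.add_mem _ (C_mem_freeSpan _ _) (Submodule.sum_mem _ fun v _ => ?_)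
  rw [smul_eq_C_mul, map_mul, liftAB_C, liftAB_X, ← smul_eq_C_mul]
  exact Submodule.smul_mem _ _ (X_mem_freeSpan _ _)

/-! ## The unconditional osculating coefficient identity -/

section Probe

variable (i j j' l : Fin n)

/-- The `(a,b)`-probe `a_ij ↦ s`, `b_j'l ↦ u`, everything else `↦ 0`. -/
def probeAB : MatMulVars n → MvPolynomial (Fin 2) ℂ := fun v =>
  if v = Sum.inl (i, j) then X 0 else if v = Sum.inr (j', l) then X 1 else 0

/-- The graph probe of `coeffIdentity`: additionally `c_il ↦ [j = j']·s u`, other `c ↦ 0`. -/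
def probeG : GraphVars n → MvPolynomial (Fin 2) ℂ := fun v =>
  if v = Sum.inl (Sum.inl (i, j)) then X 0
  else if v = Sum.inl (Sum.inr (j', l)) then X 1
  else if v = Sum.inr (i, l) then C (if j = j' then (1 : ℂ) else 0) * (X 0 * X 1)
  else 0

/-- On the `A,B`-variables the graph probe is the `(a,b)`-probe. -/
theorem probeG_inl (v : MatMulVars n) :
    probeG i j j' l (Sum.inl v) = probeAB i j j' l v := by
  unfold probeG probeAB
  rcases v with v | v <;> simp

/-- `res (a_v) = a_v`, `res (b_v) = b_v`. -/
@[simp] theorem graphRestrict_X_inl (v : MatMulVars n) :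
    graphRestrict n (X (Sum.inl v) : MvPolynomial (GraphVars n) ℂ) = X v := by
  simp [graphRestrict_apply, liftF]

/-- `res (c_q) = Σ_k a_{q₁k} b_{kq₂}`. -/
@[simp] theorem graphRestrict_X_inr (q : Fin n × Fin n) :
    graphRestrict n (X (Sum.inr q) : MvPolynomial (GraphVars n) ℂ) =
      ∑ k, X (Sum.inl (q.1, k)) * X (Sum.inr (k, q.2)) := by
  simp [graphRestrict_apply, liftF]

/-- `res (C c) = C c`. -/
@[simp] theorem graphRestrict_C (c : ℂ) :
    graphRestrict n (C c : MvPolynomial (GraphVars n) ℂ) = C c := by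
  simp [graphRestrict_apply, liftF]

/-- **The graph probe factors through the graph restriction**:
`t ∘ probeG = (t|_W) ∘ probeAB`. -/
theorem bind₁_probeG_eq (t : MvPolynomial (GraphVars n) ℂ) :
    bind₁ (probeG i j j' l) t = bind₁ (probeAB i j j' l) (graphRestrict n t) := by
  classical
  have h : (bind₁ (probeG i j j' l) : MvPolynomial (GraphVars n) ℂ →ₐ[ℂ] _).toRingHom =
      (bind₁ (probeAB i j j' l) : MvPolynomial (MatMulVars n) ℂ →ₐ[ℂ] _).toRingHom.comp
        (graphRestrict n) := by
    refine ringHom_ext (fun c => by simp) (fun v => ?_)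
    rcases v with v | ⟨p, q⟩
    · simp [probeG_inl]
    · simp only [AlgHom.toRingHom_eq_coe, RingHom.coe_coe, bind₁_X_right, RingHom.coe_comp,
        Function.comp_apply, graphRestrict_X_inr, map_sum, map_mul]
      -- evaluate the probe on `Σ_k a_pk b_kq`
      have hsum : ∑ k : Fin n, probeAB i j j' l (Sum.inl (p, k)) * probeAB i j j' l (Sum.inr (k, q)) =
          if (p, q) = (i, l) then C (if j = j' then (1 : ℂ) else 0) * (X 0 * X 1) else 0 := by
        by_cases hp : p = i
        · subst hp
          by_cases hq : q = l
          · subst hq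
            rw [Finset.sum_eq_single j]
            · by_cases hjj : j = j'
              · subst hjj; simp [probeAB]
              · simp [probeAB, hjj]
            · intro k _ hk; simp [probeAB, hk]
            · intro h; exact absurd (Finset.mem_univ j) h
          · rw [Finset.sum_eq_zero]
            · simp [hq]
            · intro k _; simp [probeAB, hq]
        · rw [Finset.sum_eq_zero]
          · simp [hp]
          · intro k _; simp [probeAB, hp]
      rw [hsum]
      unfold probeG
      simp only [reduceCtorEq, if_false, Sum.inr.injEq]
  exact RingHom.congr_fun h t

/-- The linear `c_q`-coefficient of `ι g` vanishes. -/
theorem coeff_single_inr_liftAB (q : Fin n × Fin n) (g : MvPolynomial (MatMulVars n) ℂ) :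
    coeff (Finsupp.single (Sum.inr q : GraphVars n) 1) (liftAB n g) = 0 := by
  have h := coeff_pderiv (i := (Sum.inr q : GraphVars n)) (liftAB n g) 0
  simp only [pderiv_inr_liftAB, coeff_zero, zero_add, Finsupp.coe_zero, Pi.zero_apply,
    Nat.cast_zero, mul_one] at h
  exact h.symm

/-- `coeff_{a_ij b_j'l}(ι g) = coeff_{a_ij b_j'l}(g)`. -/
theorem coeff_ab_liftAB (g : MvPolynomial (MatMulVars n) ℂ) :
    coeff (Finsupp.single (Sum.inl (Sum.inl (i, j)) : GraphVars n) 1 +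
        Finsupp.single (Sum.inl (Sum.inr (j', l)) : GraphVars n) 1) (liftAB n g) =
      coeff (Finsupp.single (Sum.inl (i, j) : MatMulVars n) 1 +
        Finsupp.single (Sum.inr (j', l) : MatMulVars n) 1) g := by
  have h := coeff_rename_mapDomain (Sum.inl : MatMulVars n → GraphVars n) Sum.inl_injective g
    (Finsupp.single (Sum.inl (i, j) : MatMulVars n) 1 + Finsupp.single (Sum.inr (j', l)) 1)
  rw [Finsupp.mapDomain_add, Finsupp.mapDomain_single, Finsupp.mapDomain_single] at h
  exact h

/-- The `s u`-coefficient of `g ∘ probeAB` is `coeff_{a_ij b_j'l}(g)` for `g ∈ ℂ[A,B]`. -/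
theorem coeff_bind₁_probeAB (g : MvPolynomial (MatMulVars n) ℂ) :
    coeff (Finsupp.single (0 : Fin 2) 1 + Finsupp.single 1 1) (bind₁ (probeAB i j j' l) g) =
      coeff (Finsupp.single (Sum.inl (i, j) : MatMulVars n) 1 +
        Finsupp.single (Sum.inr (j', l) : MatMulVars n) 1) g := by
  classical
  have hab : (Sum.inl (Sum.inl (i, j)) : GraphVars n) ≠ Sum.inl (Sum.inr (j', l)) := by simp
  have hac : (Sum.inl (Sum.inl (i, j)) : GraphVars n) ≠ Sum.inr (i, l) := Sum.inl_ne_inr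
  have hbc : (Sum.inl (Sum.inr (j', l)) : GraphVars n) ≠ Sum.inr (i, l) := Sum.inl_ne_inr
  have h := probe_coeff_bind₁ (probeG i j j' l) _ _ _ (if j = j' then (1 : ℂ) else 0) hab hac hbc
    (by simp [probeG]) (by simp [probeG]) (by simp [probeG])
    (by intro v h1 h2 h3; simp [probeG, h1, h2, h3]) (liftAB n g)
  rw [bind₁_probeG_eq, graphRestrict_liftAB, coeff_single_inr_liftAB, mul_zero, add_zero,
    coeff_ab_liftAB] at h
  exact h

/-- **Osculating coefficient identity (unconditional).**  For every `t ∈ ℂ[A,B,C]`: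
`coeff_{a_ij b_j'l}(t|_W) = coeff_{a_ij b_j'l}(t) + [j = j']·coeff_{c_il}(t)`. -/
theorem coeff_ab_graphRestrict (t : MvPolynomial (GraphVars n) ℂ) :
    coeff (Finsupp.single (Sum.inl (i, j) : MatMulVars n) 1 +
        Finsupp.single (Sum.inr (j', l) : MatMulVars n) 1) (graphRestrict n t) =
      coeff (Finsupp.single (Sum.inl (Sum.inl (i, j)) : GraphVars n) 1 +
          Finsupp.single (Sum.inl (Sum.inr (j', l)) : GraphVars n) 1) t +
        (if j = j' then coeff (Finsupp.single (Sum.inr (i, l) : GraphVars n) 1) t else 0) := by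
  classical
  have hab : (Sum.inl (Sum.inl (i, j)) : GraphVars n) ≠ Sum.inl (Sum.inr (j', l)) := by simp
  have hac : (Sum.inl (Sum.inl (i, j)) : GraphVars n) ≠ Sum.inr (i, l) := Sum.inl_ne_inr
  have hbc : (Sum.inl (Sum.inr (j', l)) : GraphVars n) ≠ Sum.inr (i, l) := Sum.inl_ne_inr
  have h := probe_coeff_bind₁ (probeG i j j' l) _ _ _ (if j = j' then (1 : ℂ) else 0) hab hac hbc
    (by simp [probeG]) (by simp [probeG]) (by simp [probeG])
    (by intro v h1 h2 h3; simp [probeG, h1, h2, h3]) t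
  rw [bind₁_probeG_eq, coeff_bind₁_probeAB] at h
  rw [h]
  by_cases hjj : j = j' <;> simp [hjj]

end Probe

/-! ## The osculating identity of a deflated test -/

/-- `coeff 0 (r_q(t)) = coeff_{c_q}(t)`: the constant term of the row polynomial is the linear
`C`-coefficient (the Jacobian entry at the origin). -/
theorem coeff_zero_rowPoly (t : MvPolynomial (GraphVars n) ℂ) (q : Fin n × Fin n) :
    coeff 0 (rowPoly t q) = coeff (Finsupp.single (Sum.inr q : GraphVars n) 1) t := by
  have h1 : coeff 0 (rowPoly t q) = eval 0 (rowPoly t q) := by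
    rw [eval_zero, constantCoeff_eq]
  rw [h1, eval_rowPoly, graphPoint_zero]
  have h := coeff_pderiv (i := (Sum.inr q : GraphVars n)) t 0
  simp only [zero_add, Finsupp.coe_zero, Pi.zero_apply, Nat.cast_zero, mul_one] at h
  rw [eval_zero, constantCoeff_eq, h]

/-- **Osculating identity of a deflated test.**  Let `t ∈ ℂ[A,B,C]`, `ξ` any coefficient field and
`M_q ∈ ℂ[A,B]` any polynomials such that the `a_ij b_j'l`-coefficient of
`Σ_q ξ_q·r_q(t) + Σ_q coeff_{c_q}(t)·M_q` vanishes (LIFT).  Then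
`coeff_{a_ij b_j'l}(D_ξ t) = −[j=j']·coeff_{c_il}(D_ξ t) − Σ_q coeff_{c_q}(t)·coeff_{a_ij b_j'l}(M_q)`. -/
theorem oscId_derivC (t : MvPolynomial (GraphVars n) ℂ)
    (ξ M : Fin n × Fin n → MvPolynomial (MatMulVars n) ℂ) (i j j' l : Fin n)
    (hlift : coeff (Finsupp.single (Sum.inl (i, j) : MatMulVars n) 1 +
        Finsupp.single (Sum.inr (j', l) : MatMulVars n) 1)
        (∑ q, ξ q * rowPoly t q +
          ∑ q, C (coeff (Finsupp.single (Sum.inr q : GraphVars n) 1) t) * M q) = 0) :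
    coeff (Finsupp.single (Sum.inl (Sum.inl (i, j)) : GraphVars n) 1 +
        Finsupp.single (Sum.inl (Sum.inr (j', l)) : GraphVars n) 1) (derivC ξ t) =
      -(if j = j' then coeff (Finsupp.single (Sum.inr (i, l) : GraphVars n) 1) (derivC ξ t)
          else 0) -
        ∑ q, coeff (Finsupp.single (Sum.inr q : GraphVars n) 1) t *
          coeff (Finsupp.single (Sum.inl (i, j) : MatMulVars n) 1 +
            Finsupp.single (Sum.inr (j', l) : MatMulVars n) 1) (M q) := by
  have h := coeff_ab_graphRestrict i j j' l (derivC ξ t)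
  rw [graphRestrict_derivC] at h
  have h2 : coeff (Finsupp.single (Sum.inl (i, j) : MatMulVars n) 1 +
        Finsupp.single (Sum.inr (j', l) : MatMulVars n) 1)
      (∑ q, C (coeff (Finsupp.single (Sum.inr q : GraphVars n) 1) t) * M q) =
      ∑ q, coeff (Finsupp.single (Sum.inr q : GraphVars n) 1) t *
          coeff (Finsupp.single (Sum.inl (i, j) : MatMulVars n) 1 +
            Finsupp.single (Sum.inr (j', l) : MatMulVars n) 1) (M q) := by
    rw [coeff_sum]
    exact Finset.sum_congr rfl fun q _ => coeff_C_mul _ _ _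
  rw [coeff_add, h2] at hlift
  linear_combination hlift - h

end Summit.MatrixMultiplication.MatrixMultiplication.Theorems.GraphEquations

end
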